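import Literature.AlgebraicGeometry.Motives.CyclesPushforwardRelDimOneProofs
import Literature.AlgebraicGeometry.Motives.ProjectiveLineInvolution
import HarnessLib

/-!
# Proper push-forward preserves rational equivalence (Fulton Thm. 1.4; Stacks 02S2): discharges

This file closes the named fact `Literature.AlgebraicGeometry.Motives.map_mem_ratTrivial`
(Stacks, Chow Homology, Lemma 42.20.3 = Tag 02S2; Fulton, *Intersection Theory*, Thm. 1.4: for a
proper morphism `p : X → Y` of schemes locally of finite type over a field and a `d`-cycle `α` on
`X` rationally equivalent to zero, `p_* α` is rationally equivalent to zero), through the reduction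
`Literature.AlgebraicGeometry.Motives.map_mem_ratTrivial_of_facts`
(`Motives/CyclesPushforwardFacts`, Fulton's Prop. 1.4 on a generator `[div(r)]`, `r ∈ R(W)^*`,
`W ⊆ X` a subvariety) to the two cases of Fulton's Prop. 1.4 / Stacks 02RT–02RU:

* `Literature.AlgebraicGeometry.Motives.map_div_eq_zero_of_dim_eq_add_one_holds` —
  **Prop. 1.4 (a)**, `p_* div(f) = 0` when `dim X = dim Y + 1`: the assembly
  `map_div_eq_zero_of_dim_eq_add_one_of_projectiveLine`
  (`Motives/CyclesPushforwardRelDimOneProofs`: algebraic case, closure of the graph of `f`,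
  Stacks 02RT twice, Stacks 02R5, and the symmetry `t ↦ t⁻¹` of `ℙ¹`) fed with the
  projective line package `Literature.AlgebraicGeometry.Motives.ProjLine.exists_projectiveLine`
  (`Motives/ProjectiveLineInvolution`);
* **Prop. 1.4 (b)** / Stacks 02RT, `p_* div(f) = div(Nm f)` when `dim X = dim Y`, is
  `Literature.AlgebraicGeometry.Motives.map_div_eq_div_norm_holds`
  (`Motives/CyclesPushforwardNormProofs`, from Stacks 02MJ and 02RM);
* `Literature.AlgebraicGeometry.Motives.map_mem_ratTrivial_holds` — **the discharge of
  `map_mem_ratTrivial`**.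

Everything here is proved.

## References

* [StacksProject] The Stacks Project, Chow Homology, Lemma 42.20.3 (Tag 02S2), with Lemmas
  42.18.1 (Tag 02RT), 42.18.2 (Tag 02RU), 42.16.2 (Tag 02RM), 42.12.2 (Tag 02R5); Algebra,
  Lemma 10.121.8 (Tag 02MJ).
* [Fulton1998] W. Fulton, *Intersection Theory*, 2nd ed., Springer (1998), Thm. 1.4 and Prop. 1.4
  with their proofs, pp. 11–13; App. A.1–A.3.
-/

open CategoryTheory AlgebraicGeometry Order

universe u

namespace Literature.AlgebraicGeometry.Motives

/-- **Fulton, Prop. 1.4 (a); Stacks 02S2, the case `dim Z' = dim Z + 1`** — discharge of the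
named fact `Literature.AlgebraicGeometry.Motives.map_div_eq_zero_of_dim_eq_add_one`: for
`p : X → Y` proper dominant of integral schemes locally of finite type over a field with
`dim X = dim Y + 1` and `f ∈ R(X)^*`, `p_* div(f) = 0`
(`map_div_eq_zero_of_dim_eq_add_one_of_projectiveLine` with the projective line package
`ProjLine.exists_projectiveLine`).
[cite: Fulton1998, Prop. 1.4 (a)] [cite: StacksProject, Tag 02S2] -/
theorem map_div_eq_zero_of_dim_eq_add_one_holds : map_div_eq_zero_of_dim_eq_add_one.{u} :=
  map_div_eq_zero_of_dim_eq_add_one_of_projectiveLine fun k _ ↦ ProjLine.exists_projectiveLine k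

variable (d : ℕ) {k : Type u} [Field k]

/-- **Stacks, Chow Homology, Lemma 42.20.3 (Tag 02S2); Fulton, *Intersection Theory*, Thm. 1.4:
proper push-forward preserves rational equivalence** — discharge of the named fact
`Literature.AlgebraicGeometry.Motives.map_mem_ratTrivial`: for a proper morphism `p : X → Y`
of schemes locally of finite type over a field `k` and a `d`-cycle `c ∈ Rat_d(X)`,
`p_* c ∈ Rat_d(Y)`. By `map_mem_ratTrivial_of_facts` (Fulton's reduction to a generator
`[div(r)]` on a subvariety `W`, and to `W → p(W)`), from Prop. 1.4 (a)
(`map_div_eq_zero_of_dim_eq_add_one_holds`) and Prop. 1.4 (b) = Stacks 02RT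
(`map_div_eq_div_norm_holds`).
[cite: StacksProject, Tag 02S2] [cite: Fulton1998, Thm. 1.4] -/
theorem map_mem_ratTrivial_holds : map_mem_ratTrivial d (k := k) :=
  map_mem_ratTrivial_of_facts map_div_eq_zero_of_dim_eq_add_one_holds map_div_eq_div_norm_holds d

end Literature.AlgebraicGeometry.Motives
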